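import Summits.QuantumFields.BalabanUV.Beta.GAN24.TentBackgroundLegs

/-!
# `BalabanUV.Beta.GAN24.OneStepLoopContractionTwoKernels` — binder row G-an2-4 ∕ (CONV-C), routes C-R6° («VALUES») × R7 («TWO CURRENCIES»), PART 203:
# THE TWO-KERNEL ONE-LOOP CONTRACTION `Γ_{1,k}(Y_k ⊗ₖ Z_k)Γ_{2,k}ᴴ` WITH MOVING LEGS — (UD)+(SR) AND THE `ℤ^d` END FOR ANY TWO INPUT TRIPLES, AND THE TADPOLE-SHAPED CONTRACTION OF
# CENSUS V196 `(i,j) ↦ tr(𝒢c⁻¹X_ic⁻¹X_jc⁻¹) = tr(Y X_i c⁻¹ X_j)` (`Y = c⁻¹𝒢c⁻¹`, one propagator of the loop replaced by `c_k⁻¹`) WITH THE INSERTION-WORD LEGS DISCHARGED, and for the tent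
# family with NOTHING displayed.  PARTs 196 ∕ 197 ∕ 200 ∕ 202 dress `Y ⊗ₖ Y`; PART 130's `entryDecay_kronecker` ∕ `twoLevelDecayRate_kronecker` and PART 150's `tendsto_legs_pair` are
# already two-kernel, so the second kernel is free bookkeeping; the second triple is PART 195's `inv_unitCovB_inputs` (`c_k⁻¹ = Σ_k + a·1`: PART 132's decay + PART 194's EL₂, every
# cubic volume sequence) (unit b2b-balaban-gan24-p3, gen 62; v1)

NOT IN PRINT; OUR PROOF ([folklore] bookkeeping BY NAME over PART 197 (`twoLevelDecayRate_vertexDress_moving`), PART 131 (`entryDecay_vertexDress`), PART 130 (`entryDecay_kronecker`,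
`twoLevelDecayRate_kronecker`, `twoLevelDecayRate_const_nonneg`), PART 132 (`sum_exp_pairDistK_le`, `distK_legs_laws`), PART 140 (`conv_of_decay_of_tendsto`), PART 150 (`tendsto_legs_pair`),
PART 153 (`exp_distK_le_exp_window_pair'`), PART 143 (`norm_le_of_entryDecay`), PART 156 (`inputs_of_le_rate`), PART 195 (`exists_loopCov_inputs`, `inv_unitCovB_inputs`), PART 200
(`insertionLegs_envelopes`, `insertionLegs_tendsto`), PART 201 ∕ 202 (the tent family); [Balaban1987RG1] (1.20)–(1.22) p. 264 LOCATE the one-loop shapes; nothing printed is a hypothesis).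
HONEST FRAMING (cell contract, verbatim): «discharging `BetaPertH` makes Bałaban's UV stability UNCONDITIONAL — a real constructive-QFT result; it is NOT the
continuum limit and NOT the Clay problem.»  HONEST DEPENDENCY (verbatim): «continuum YM on T⁴ ⇐ BetaPertH ∧ nine spine estimates (0/9 proved); BetaPertH ⇐
(D1) ∧ (D4) ∧ CAP+tail; G-an2-4 gates asym, D1 and NE2/3/4.»

WHAT THIS FILE PROVES (0 sorry, 0 `def`; `M_t = fine (Lb·1) (cubic (d+1) (s t))`, `Y_{t,k}` = PART 195's loop covariance, `Z_{t,k} = c_{k,t}⁻¹ = (unitCovB L M_t a ha k)⁻¹`,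
`Γ_{t,k} = Matrix.of (x,(q,r)) ↦ X_{t,x,k}(q,r)` the insertion-word legs):
* §1 (torus `idx L M 0`, `d ≥ 2`) **`decay_twoKernel_of_inputs_moving`** — (UD) `γ₁γ₂C` + (SR) `(γ₁′γ₂ + γ₁γ₂′)C + γ₁γ₂C′` of `Γ_{1,k}(Y_k ⊗ₖ Z_k)Γ_{2,k}ᴴ` for ANY two towers with the
  triples' decay clauses (`(B₁, B₁′)`, `(B₂, B₂′)`, common rate and ratio) and moving legs with level ∕ step envelopes.
* §2 (cubic `side t → ∞`) **`conv_twoKernel_of_inputs_moving`** — the `ℤ^d` END (`IsInfiniteVolumeLimit`, `UniformDecay`, `StepRate θ`, `KernelInputs`, second moments) for ANY two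
  volume-indexed INPUT triples (`θ < 1`) and moving legs with EL₃ at every level.
* §3 **`conv_loopCov_invCov_moving_of_rate`** — §2 for `(Y, Z) = (c⁻¹𝒢c⁻¹, c⁻¹)` of the gauge-fixed one-loop step (dimension `d + 1 ≥ 2`, `L ≥ 2`, every `Lb`, `a`, every cubic coarse volume
  sequence), legs at ANY prescribed rate `κ_Γ` with step ratio `√(L⁻¹)`; conclusion at the minimum rate.
* §4 **`conv_loopCov_invCov_insertionLegs`** — §3 with the insertion-word legs of every localised Lipschitz family with pointwise limits DISCHARGED (PART 200 §1–§2; `d + 1 ≥ 3`,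
  `s = evenPeriod`); **`conv_loopCov_invCov_tentLegs`** — the tent family, NOTHING displayed.
WHAT IT DOES NOT DO: the other tadpole `tr(Yc⁻¹X_{[i,j]}c⁻¹)`-type contraction with ONE two-vertex word (needs the three-point decay of `𝒢P_i𝒢P_j𝒢` about `i` AND `j` — the two-weight
dictionary of PART 198 with two centres; next); the signed sum of the second-order terms and its identification with Bałaban's `Π⁰` (row an1's dictionary); the indicator family.
SUPPLIER work; NEVER «G-an2-4 closed»; NOT (CONV-C), NOT D1, NOT `BetaPertH`, NOT continuum, NOT Clay.  Records: `HOME/b2b-balaban-gan24-p3/gen62/README.md`.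
-/

noncomputable section

open scoped BigOperators ComplexConjugate Matrix Matrix.Norms.L2Operator Kronecker
open Filter Topology Finset Matrix

namespace Summit.QuantumFields.BalabanUV.Beta.GAN24.OneStepLoopContractionTwoKernels

open Literature.MathematicalPhysics.QuantumFieldTheory.Balaban1983to89
open Literature.MathematicalPhysics.QuantumFieldTheory.Balaban1983to89.B5Prop11Plancherel (Tor fine)
open Literature.MathematicalPhysics.QuantumFieldTheory.Balaban1983to89.B5RealFields (reM)
open Literature.MathematicalPhysics.QuantumFieldTheory.Balaban1983to89.B5G183RateUnitTower (lev)
open Literature.MathematicalPhysics.QuantumFieldTheory.Balaban1983to89.B12Sec2to5 (l1 betaPrime510)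
open Literature.MathematicalPhysics.QuantumFieldTheory.Balaban1983to89.Beta (IsInfiniteVolumeLimit windowMap)
open Literature.MathematicalPhysics.QuantumFieldTheory.Balaban1983to89.Beta.FreeLegDictionary (cubic)
open Literature.MathematicalPhysics.QuantumFieldTheory.Balaban1983to89.Beta.BlockKernelVolumeSockets (evenPeriod tendsto_evenPeriod)
open Literature.MathematicalPhysics.QuantumFieldTheory.Balaban1983to89.Beta.VectorTails (castT)
open Literature.MathematicalPhysics.QuantumFieldTheory.Balaban1983to89.Beta.LimitRate (StepRate limKernelOf KernelInputs)
open Literature.MathematicalPhysics.QuantumFieldTheory.Balaban1983to89.Beta.CompositionSingular (flucCov)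
open Literature.MathematicalPhysics.QuantumFieldTheory.Balaban1983to89.Beta.BlockEffectiveAction (DelK)
open Summit.QuantumFields.BalabanUV.T4Continuum.BalabanLineAverage (QB)
open Summit.QuantumFields.BalabanUV.T4Continuum.BalabanAveragedTowerModes (par rem)
open Summit.QuantumFields.BalabanUV.T4Continuum.CovariantAveragingTower (avgTow)
open Summit.QuantumFields.BalabanUV.T4Continuum.BalabanAveragedTowerUnit (idx QBlev calGlev unitCovB one_le_lev')
open Summit.QuantumFields.BalabanUV.T4Continuum.BalabanAveragedCoerciveTower (unitIdx)
open Summit.QuantumFields.BalabanUV.T4Continuum.CTKingTowerWeights (rho distK)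
open Summit.QuantumFields.BalabanUV.T4Continuum.FirstOrderBackgroundModel (LipschitzBackground Pmodel)
open Summit.QuantumFields.BalabanUV.T4Continuum.DecayRateInterpolation (EntryDecay TwoLevelDecayRate)
open Summit.QuantumFields.BalabanUV.Beta.GAN24.DiagramDecayAlgebra (entryDecay_kronecker twoLevelDecayRate_kronecker twoLevelDecayRate_const_nonneg twoLevelDecayRate_of_le_rate)
open Summit.QuantumFields.BalabanUV.Beta.GAN24.DiagramDecayVertices (entryDecay_vertexDress)
open Summit.QuantumFields.BalabanUV.Beta.GAN24.UnitLatticeDecayAlgebra (distK_nonneg)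
open Summit.QuantumFields.BalabanUV.Beta.GAN24.EffectiveFormDecay (entryDecay_of_le_rate)
open Summit.QuantumFields.BalabanUV.Beta.GAN24.DiagramDecayTorus (sum_exp_pairDistK_le distK_legs_laws)
open Summit.QuantumFields.BalabanUV.Beta.GAN24.DiagramVolumeLimit (conv_of_decay_of_tendsto)
open Summit.QuantumFields.BalabanUV.Beta.GAN24.DiagramVolumeLimitSandwich (norm_le_of_entryDecay)
open Summit.QuantumFields.BalabanUV.Beta.GAN24.DiagramVolumeLimitLegs (tendsto_legs_pair)
open Summit.QuantumFields.BalabanUV.Beta.GAN24.DiagramVolumeLimitOneLoop (exp_distK_le_exp_window_pair')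
open Summit.QuantumFields.BalabanUV.Beta.GAN24.InsertionChainVolumeLimit (inputs_of_le_rate)
open Summit.QuantumFields.BalabanUV.Beta.GAN24.OneStepLoopCovarianceInputTriple (exists_loopCov_inputs inv_unitCovB_inputs)
open Summit.QuantumFields.BalabanUV.Beta.GAN24.OneStepLoopContractionMovingLegs (twoLevelDecayRate_vertexDress_moving)
open Summit.QuantumFields.BalabanUV.Beta.GAN24.OneStepLoopContractionLegs (insertionLegs_envelopes insertionLegs_tendsto)
open Summit.QuantumFields.BalabanUV.Beta.GAN24.KingWeightTwoLevel (lipschitzBackground_tent rho_nonpos_of_tent_ne_zero)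
open Summit.QuantumFields.BalabanUV.Beta.GAN24.TentBackgroundLegs (tendsto_tent_reading)

variable {d : ℕ} (L : ℕ) [NeZero L]

/-! ## §1 (UD)+(SR) of the two-kernel contraction with moving legs -/

/-- **`decay_twoKernel_of_inputs_moving` — (UD)+(SR) OF `Γ_{1,k}(Y_k ⊗ₖ Z_k)Γ_{2,k}ᴴ` FOR ANY TWO TOWERS WITH THE TRIPLES' DECAY CLAUSES AND MOVING LEGS** (`d ≥ 2`, `κ > 0`,
`B₁, B₁′, B₂, B₂′, θ ≥ 0`): `∃ C, C′ ≥ 0` (from `(d, κ, B₁, B₁′, B₂, B₂′)`) such that on EVERY torus, for all towers `Y, Z` with `EntryDecay distK (Y k) B₁ κ`, `TwoLevelDecayRate distK Y B₁′ κ θ`,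
`EntryDecay distK (Z k) B₂ κ`, `TwoLevelDecayRate distK Z B₂′ κ θ` and all level-indexed legs with level envelope `γᵢe^{−κ(distK x q₁ + distK x q₂)}` and step envelope `γᵢ′θ^k e^{−κ(…)}`:
`EntryDecay distK (Γ_{1,k}(Y_k ⊗ₖ Z_k)Γ_{2,k}ᴴ) (γ₁γ₂C) (κ∕4)` for all `k` and `TwoLevelDecayRate distK (k ↦ Γ_{1,k}(Y_k ⊗ₖ Z_k)Γ_{2,k}ᴴ) ((γ₁′γ₂ + γ₁γ₂′)C + γ₁γ₂C′) (κ∕4) θ` — PART 197 §2 with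
two kernels. [folklore] -/
theorem decay_twoKernel_of_inputs_moving (hd : 2 ≤ d) {B₁ B₁' B₂ B₂' κ θ : ℝ} (hκ : 0 < κ) (hB₁ : 0 ≤ B₁) (hB₁' : 0 ≤ B₁') (hB₂ : 0 ≤ B₂) (hB₂' : 0 ≤ B₂') (hθ : 0 ≤ θ) :
    ∃ C C' : ℝ, 0 ≤ C ∧ 0 ≤ C' ∧ ∀ (M : Fin d → ℕ) [∀ μ, NeZero (M μ)] (Y Z : ℕ → Matrix (idx L M 0) (idx L M 0) ℂ),
      (∀ k, EntryDecay (distK L M) (Y k) B₁ κ) → TwoLevelDecayRate (distK L M) Y B₁' κ θ →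
      (∀ k, EntryDecay (distK L M) (Z k) B₂ κ) → TwoLevelDecayRate (distK L M) Z B₂' κ θ →
      ∀ (γ₁ γ₂ γ₁' γ₂' : ℝ), 0 ≤ γ₁ → 0 ≤ γ₂ → 0 ≤ γ₁' → 0 ≤ γ₂' → ∀ (Γ₁ Γ₂ : ℕ → Matrix (idx L M 0) (idx L M 0 × idx L M 0) ℂ),
      (∀ k x q, ‖Γ₁ k x q‖ ≤ γ₁ * Real.exp (-(κ * (distK L M x q.1 + distK L M x q.2)))) →
      (∀ k x q, ‖Γ₂ k x q‖ ≤ γ₂ * Real.exp (-(κ * (distK L M x q.1 + distK L M x q.2)))) →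
      (∀ k x q, ‖(Γ₁ (k + 1) - Γ₁ k) x q‖ ≤ γ₁' * θ ^ k * Real.exp (-(κ * (distK L M x q.1 + distK L M x q.2)))) →
      (∀ k x q, ‖(Γ₂ (k + 1) - Γ₂ k) x q‖ ≤ γ₂' * θ ^ k * Real.exp (-(κ * (distK L M x q.1 + distK L M x q.2)))) →
      (∀ k, EntryDecay (distK L M) (Γ₁ k * (Y k ⊗ₖ Z k) * (Γ₂ k)ᴴ) (γ₁ * γ₂ * C) (κ / 4)) ∧
      TwoLevelDecayRate (distK L M) (fun k => Γ₁ k * (Y k ⊗ₖ Z k) * (Γ₂ k)ᴴ) (((γ₁' * γ₂ + γ₁ * γ₂') * C + γ₁ * γ₂ * C')) (κ / 4) θ := by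
  obtain ⟨S₁, hS₁0, hS₁⟩ := sum_exp_pairDistK_le (d := d) hd (half_pos hκ)
  obtain ⟨S₂, hS₂0, hS₂⟩ := sum_exp_pairDistK_le (d := d) hd (by positivity : 0 < κ / 4)
  refine ⟨B₁ * B₂ * ((d * S₁) * (d * S₁) * ((d * S₂) * (d * S₂))), (B₁' * B₂ + B₁ * B₂') * ((d * S₁) * (d * S₁) * ((d * S₂) * (d * S₂))), by positivity, by positivity,
    fun M _ Y Z hudY hsrY hudZ hsrZ γ₁ γ₂ γ₁' γ₂' hγ₁ hγ₂ hγ₁' hγ₂' Γ₁ Γ₂ hΓ₁ hΓ₂ hΓ₁' hΓ₂' => ?_⟩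
  obtain ⟨hDp, hDD, hD0⟩ := distK_legs_laws L M
  have hpair0 : ∀ q r : idx L M 0 × idx L M 0, 0 ≤ distK L M q.1 r.1 + distK L M q.2 r.2 := fun q r => add_nonneg (distK_nonneg L M _ _) (distK_nonneg L M _ _)
  have hK : ∀ k, EntryDecay (fun q r : idx L M 0 × idx L M 0 => distK L M q.1 r.1 + distK L M q.2 r.2) (Y k ⊗ₖ Z k) (B₁ * B₂) κ := fun k => entryDecay_kronecker (hudY k) (hudZ k)
  have hKr := twoLevelDecayRate_kronecker hudY hudZ hsrY hsrZ
  refine ⟨fun k => ?_, ?_⟩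
  · have := entryDecay_vertexDress (dist := distK L M) (D := fun x (q : idx L M 0 × idx L M 0) => distK L M x q.1 + distK L M x q.2) hDp hDD hpair0 hD0 hκ.le hγ₁ hγ₂
      (mul_nonneg hB₁ hB₂) (fun x => hS₁ L M (x, x)) (fun x => hS₂ L M (x, x)) (hΓ₁ k) (hΓ₂ k) (hK k)
    exact fun x y => (this x y).trans (le_of_eq (by ring))
  · have := twoLevelDecayRate_vertexDress_moving (dist := distK L M) (D := fun x (q : idx L M 0 × idx L M 0) => distK L M x q.1 + distK L M x q.2) hDp hDD hpair0 hD0 hκ.le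
      hγ₁ hγ₂ hγ₁' hγ₂' (mul_nonneg hB₁ hB₂) (by positivity : 0 ≤ B₁' * B₂ + B₁ * B₂') hθ (fun x => hS₁ L M (x, x)) (fun x => hS₂ L M (x, x)) hΓ₁ hΓ₂ hΓ₁' hΓ₂' hK hKr
    exact fun k x y => (this k x y).trans (le_of_eq (by ring))

/-! ## §2 The `ℤ^d` END of the two-kernel contraction with moving legs -/

/-- **`conv_twoKernel_of_inputs_moving` — THE TWO-KERNEL ONE-LOOP CONTRACTION OF ANY TWO INPUT TRIPLES WITH MOVING LEGS ON `ℤ^d`, MODULO ONLY THE LEGS** (`d ≥ 2`, cubic `side t → ∞`,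
`κ > 0`, `0 ≤ θ < 1`, `μ ≠ ν`): for volume-indexed towers `Y_t, Z_t` with (UD) `(B₁, κ)`, `(B₂, κ)`, (SR) `(B₁′, κ, θ)`, `(B₂′, κ, θ)` and EL₂ at unit readings, `∃ C, C′ ≥ 0` such that for ALL
`γᵢ, γᵢ′ ≥ 0` and ALL volume- and level-indexed legs with level envelope `γᵢ`, step envelope `γᵢ′θ^k` (rate `κ`) and EL₃ at every level: `∃ Π` with
`IsInfiniteVolumeLimit side (Re (Γ_{1,t,k}(Y_{t,k} ⊗ₖ Z_{t,k})Γ_{2,t,k}ᴴ)(e(·,μ′),e(0,ν′))) (Π k)`, `UniformDecay Π μ ν (γ₁γ₂C) ((κ∕4)∕d)`, `StepRate Π μ ν ((γ₁′γ₂ + γ₁γ₂′)C + γ₁γ₂C′) ((κ∕4)∕d) θ`,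
`KernelInputs d Π`, second-moment convergence — PART 197 §3 with two kernels. [cite: Balaban1987RG1, (1.21)–(1.22) p.264 (shapes)] [folklore] -/
theorem conv_twoKernel_of_inputs_moving (hd : 2 ≤ d) {side : ℕ → ℕ} [∀ t, NeZero (side t)] (hside : Tendsto side atTop atTop)
    {Y Z : (t : ℕ) → ℕ → Matrix (idx L (cubic d (side t)) 0) (idx L (cubic d (side t)) 0) ℂ} {B₁ B₁' B₂ B₂' κ θ : ℝ}
    (hκ : 0 < κ) (hB₁ : 0 ≤ B₁) (hB₁' : 0 ≤ B₁') (hB₂ : 0 ≤ B₂) (hB₂' : 0 ≤ B₂') (hθ0 : 0 ≤ θ) (hθ1 : θ < 1)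
    (hudY : ∀ t k, EntryDecay (distK L (cubic d (side t))) (Y t k) B₁ κ) (hsrY : ∀ t, TwoLevelDecayRate (distK L (cubic d (side t))) (Y t) B₁' κ θ)
    (hudZ : ∀ t k, EntryDecay (distK L (cubic d (side t))) (Z t k) B₂ κ) (hsrZ : ∀ t, TwoLevelDecayRate (distK L (cubic d (side t))) (Z t) B₂' κ θ)
    (helY : ∀ k (μ ν : Fin d) (z z' : Fin d → ℤ), ∃ s' : ℂ, Tendsto (fun t => Y t k ((unitIdx L (cubic d (side t))).symm (castT (cubic d (side t)) z, μ))
      ((unitIdx L (cubic d (side t))).symm (castT (cubic d (side t)) z', ν))) atTop (𝓝 s'))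
    (helZ : ∀ k (μ ν : Fin d) (z z' : Fin d → ℤ), ∃ s' : ℂ, Tendsto (fun t => Z t k ((unitIdx L (cubic d (side t))).symm (castT (cubic d (side t)) z, μ))
      ((unitIdx L (cubic d (side t))).symm (castT (cubic d (side t)) z', ν))) atTop (𝓝 s'))
    {μ ν : Fin d} (hne : μ ≠ ν) :
    ∃ C C' : ℝ, 0 ≤ C ∧ 0 ≤ C' ∧ ∀ (γ₁ γ₂ γ₁' γ₂' : ℝ), 0 ≤ γ₁ → 0 ≤ γ₂ → 0 ≤ γ₁' → 0 ≤ γ₂' →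
      ∀ (Γ₁ Γ₂ : (t k : ℕ) → Matrix (idx L (cubic d (side t)) 0) (idx L (cubic d (side t)) 0 × idx L (cubic d (side t)) 0) ℂ),
      (∀ t k x q, ‖Γ₁ t k x q‖ ≤ γ₁ * Real.exp (-(κ * (distK L (cubic d (side t)) x q.1 + distK L (cubic d (side t)) x q.2)))) →
      (∀ t k x q, ‖Γ₂ t k x q‖ ≤ γ₂ * Real.exp (-(κ * (distK L (cubic d (side t)) x q.1 + distK L (cubic d (side t)) x q.2)))) →
      (∀ t k x q, ‖(Γ₁ t (k + 1) - Γ₁ t k) x q‖ ≤ γ₁' * θ ^ k * Real.exp (-(κ * (distK L (cubic d (side t)) x q.1 + distK L (cubic d (side t)) x q.2)))) →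
      (∀ t k x q, ‖(Γ₂ t (k + 1) - Γ₂ t k) x q‖ ≤ γ₂' * θ ^ k * Real.exp (-(κ * (distK L (cubic d (side t)) x q.1 + distK L (cubic d (side t)) x q.2)))) →
      (∀ k (μ' l l' : Fin d) (z u v : Fin d → ℤ), ∃ s' : ℂ, Tendsto (fun t => Γ₁ t k ((unitIdx L (cubic d (side t))).symm (castT (cubic d (side t)) z, μ'))
        ((unitIdx L (cubic d (side t))).symm (castT (cubic d (side t)) u, l), (unitIdx L (cubic d (side t))).symm (castT (cubic d (side t)) v, l'))) atTop (𝓝 s')) →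
      (∀ k (μ' l l' : Fin d) (z u v : Fin d → ℤ), ∃ s' : ℂ, Tendsto (fun t => Γ₂ t k ((unitIdx L (cubic d (side t))).symm (castT (cubic d (side t)) z, μ'))
        ((unitIdx L (cubic d (side t))).symm (castT (cubic d (side t)) u, l), (unitIdx L (cubic d (side t))).symm (castT (cubic d (side t)) v, l'))) atTop (𝓝 s')) →
      ∃ Pinf : ℕ → B12Beta.Kernel d,
        (∀ k, IsInfiniteVolumeLimit side
          (fun t μ' ν' (z : Beta.Site d (side t)) => ((Γ₁ t k * (Y t k ⊗ₖ Z t k) * (Γ₂ t k)ᴴ) ((unitIdx L (cubic d (side t))).symm (z, μ')) ((unitIdx L (cubic d (side t))).symm (0, ν'))).re) (Pinf k)) ∧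
        Beta.LimitRate.UniformDecay Pinf μ ν (γ₁ * γ₂ * C) ((κ / 4) / d) ∧ StepRate Pinf μ ν (((γ₁' * γ₂ + γ₁ * γ₂') * C + γ₁ * γ₂ * C')) ((κ / 4) / d) θ ∧
        (∃ K : KernelInputs d Pinf, K.θ = θ ∧ K.c₀ = betaPrime510 d ((((γ₁' * γ₂ + γ₁ * γ₂') * C + γ₁ * γ₂ * C')) / (1 - θ)) ((κ / 4) / d) ∧ K.Pinf = limKernelOf Pinf ∧ K.μ = μ ∧ K.ν = ν) ∧
        (∀ k, |B12Beta.secondMoment (Pinf k) μ ν - B12Beta.secondMoment (limKernelOf Pinf) μ ν| ≤ betaPrime510 d ((((γ₁' * γ₂ + γ₁ * γ₂') * C + γ₁ * γ₂ * C')) / (1 - θ)) ((κ / 4) / d) * θ ^ k) := by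
  have hd1 : 1 ≤ d := le_trans (by norm_num) hd
  have hd0 : (0 : ℝ) < d := by exact_mod_cast lt_of_lt_of_le zero_lt_one hd1
  obtain ⟨C, C', hC, hC', hmov⟩ := decay_twoKernel_of_inputs_moving L hd hκ hB₁ hB₁' hB₂ hB₂' hθ0
  refine ⟨C, C', hC, hC', fun γ₁ γ₂ γ₁' γ₂' hγ₁ hγ₂ hγ₁' hγ₂' Γ₁ Γ₂ hΓ₁ hΓ₂ hΓ₁' hΓ₂' hΓ₁el hΓ₂el => ?_⟩
  have hudL : ∀ t k, EntryDecay (distK L (cubic d (side t))) (Γ₁ t k * (Y t k ⊗ₖ Z t k) * (Γ₂ t k)ᴴ) (γ₁ * γ₂ * C) (κ / 4) :=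
    fun t => (hmov (cubic d (side t)) (Y t) (Z t) (hudY t) (hsrY t) (hudZ t) (hsrZ t) γ₁ γ₂ γ₁' γ₂' hγ₁ hγ₂ hγ₁' hγ₂' (Γ₁ t) (Γ₂ t) (hΓ₁ t) (hΓ₂ t) (hΓ₁' t) (hΓ₂' t)).1
  have hsrL : ∀ t, TwoLevelDecayRate (distK L (cubic d (side t))) (fun k => Γ₁ t k * (Y t k ⊗ₖ Z t k) * (Γ₂ t k)ᴴ) (((γ₁' * γ₂ + γ₁ * γ₂') * C + γ₁ * γ₂ * C')) (κ / 4) θ :=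
    fun t => (hmov (cubic d (side t)) (Y t) (Z t) (hudY t) (hsrY t) (hudZ t) (hsrZ t) γ₁ γ₂ γ₁' γ₂' hγ₁ hγ₂ hγ₁' hγ₂' (Γ₁ t) (Γ₂ t) (hΓ₁ t) (hΓ₂ t) (hΓ₁' t) (hΓ₂' t)).2
  -- the legs' window decay away from the root, rate `κ/d`, at one level
  have hwin : ∀ {γ : ℝ} (Γ : (t : ℕ) → Matrix (idx L (cubic d (side t)) 0) (idx L (cubic d (side t)) 0 × idx L (cubic d (side t)) 0) ℂ),
      (∀ t x q, ‖Γ t x q‖ ≤ γ * Real.exp (-(κ * (distK L (cubic d (side t)) x q.1 + distK L (cubic d (side t)) x q.2)))) → 0 ≤ γ →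
      ∀ t (x : Beta.Site d (side t)) (μ' : Fin d) (u : Beta.Site d (side t)) (l : Fin d) (v : Beta.Site d (side t)) (l' : Fin d),
        ‖Γ t ((unitIdx L (cubic d (side t))).symm (x, μ')) ((unitIdx L (cubic d (side t))).symm (u, l), (unitIdx L (cubic d (side t))).symm (v, l'))‖
          ≤ γ * (Real.exp (-(κ / d) * l1 (windowMap d (side t) (u - x))) * Real.exp (-(κ / d) * l1 (windowMap d (side t) (v - x)))) := by
    intro γ Γ hΓ hγ t x μ' u l v l'
    refine (hΓ t _ _).trans ?_
    rw [mul_add, neg_add, Real.exp_add]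
    exact mul_le_mul_of_nonneg_left (mul_le_mul (exp_distK_le_exp_window_pair' L (side t) hκ.le x μ' u l)
      (exp_distK_le_exp_window_pair' L (side t) hκ.le x μ' v l') (Real.exp_pos _).le (Real.exp_pos _).le) hγ
  refine conv_of_decay_of_tendsto L hd1 hside (by positivity : 0 < κ / 4) hθ0 hθ1 hudL hsrL ?_ hne
  intro k μ' ν' z
  have e0 : ∀ t, castT (cubic d (side t)) (0 : Fin d → ℤ) = 0 := fun t => by funext i; simp [castT]
  have hB12 : 0 ≤ max B₁ B₂ := le_max_of_le_left hB₁
  have hYb : ∀ t (i j : idx L (cubic d (side t)) 0), ‖Y t k i j‖ ≤ max B₁ B₂ := fun t i j => (norm_le_of_entryDecay L (side t) hκ.le hB₁ (hudY t k) i j).trans (le_max_left _ _)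
  have hZb : ∀ t (i j : idx L (cubic d (side t)) 0), ‖Z t k i j‖ ≤ max B₁ B₂ := fun t i j => (norm_le_of_entryDecay L (side t) hκ.le hB₂ (hudZ t k) i j).trans (le_max_right _ _)
  obtain ⟨s', hs'⟩ := tendsto_legs_pair L (side := side) hside hB12 hYb hZb (hwin (fun t => Γ₁ t k) (fun t => hΓ₁ t k) hγ₁) (hwin (fun t => Γ₂ t k) (fun t => hΓ₂ t k) hγ₂)
    (div_pos hκ hd0) (fun μ₁ ν₁ w w' => helY k μ₁ ν₁ w w') (fun μ₁ ν₁ w w' => helZ k μ₁ ν₁ w w') (hΓ₁el k) (hΓ₂el k) μ' ν' z 0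
  refine ⟨s', hs'.congr fun t => ?_⟩
  rw [e0]

/-! ## §3 `(Y, Z) = (c⁻¹𝒢c⁻¹, c⁻¹)`: the tadpole-shaped contraction of census V196, legs at any prescribed rate -/

section LoopInv

variable (Lb : ℕ) [NeZero Lb] (a : ℝ) (ha : 0 < a) (s : ℕ → ℕ) [hs0 : ∀ t, NeZero (s t)]

/-- **`conv_loopCov_invCov_moving_of_rate` — THE CONTRACTION `Γ_{1,k}(Y_k ⊗ₖ c_k⁻¹)Γ_{2,k}ᴴ` OF THE GAUGE-FIXED ONE-LOOP STEP ON `ℤ^{d+1}` WITH LEVEL-DEPENDENT LEGS, MODULO ONLY THE LEGS**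
(dimension `d + 1 ≥ 2`, `L ≥ 2`, every `Lb ≥ 1`, `a > 0`, `μ ≠ ν`, every cubic coarse volume sequence `s t → ∞`, `M_t = fine (Lb·1) (cubic (d+1) (s t))`; `Y` = PART 195's loop covariance
`c⁻¹𝒢c⁻¹`, `Z_k = c_k⁻¹`; the legs' rate `κ_Γ > 0` PRESCRIBED, step ratio `√(L⁻¹)`): `∃ 0 < κ₁ ≤ κ_Γ`, `C, C′ ≥ 0` such that for all volume- and level-indexed legs with level envelope
`γᵢe^{−κ_Γ(…)}`, step envelope `γᵢ′(√(L⁻¹))^k e^{−κ_Γ(…)}` and EL₃ at every level, the dressed contraction has limit kernels `Π` with the whole `LimitRate` END at rate `(κ₁∕4)∕(d+1)`.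
By cyclicity this is the shape of V196's tadpole `tr(𝒢c⁻¹X_ic⁻¹X_jc⁻¹) = tr(Y X_i c⁻¹ X_j)`. [cite: Balaban1987RG1, (1.20)–(1.22) p.264 (shapes)] [folklore] -/
theorem conv_loopCov_invCov_moving_of_rate (hL : 2 ≤ L) (hd : 1 ≤ d) (hs : Tendsto s atTop atTop) {μ ν : Fin (d + 1)} (hne : μ ≠ ν) {κΓ : ℝ} (hκΓ : 0 < κΓ) :
    ∃ κ₁ C C' : ℝ, 0 < κ₁ ∧ κ₁ ≤ κΓ ∧ 0 ≤ C ∧ 0 ≤ C' ∧ ∀ (γ₁ γ₂ γ₁' γ₂' : ℝ), 0 ≤ γ₁ → 0 ≤ γ₂ → 0 ≤ γ₁' → 0 ≤ γ₂' →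
      ∀ (Γ₁ Γ₂ : (t k : ℕ) → Matrix (idx L (fine (Lb * 1) (cubic (d + 1) (s t))) 0) (idx L (fine (Lb * 1) (cubic (d + 1) (s t))) 0 × idx L (fine (Lb * 1) (cubic (d + 1) (s t))) 0) ℂ),
      (∀ t k x q, ‖Γ₁ t k x q‖ ≤ γ₁ * Real.exp (-(κΓ * (distK L (fine (Lb * 1) (cubic (d + 1) (s t))) x q.1 + distK L (fine (Lb * 1) (cubic (d + 1) (s t))) x q.2)))) →
      (∀ t k x q, ‖Γ₂ t k x q‖ ≤ γ₂ * Real.exp (-(κΓ * (distK L (fine (Lb * 1) (cubic (d + 1) (s t))) x q.1 + distK L (fine (Lb * 1) (cubic (d + 1) (s t))) x q.2)))) →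
      (∀ t k x q, ‖(Γ₁ t (k + 1) - Γ₁ t k) x q‖ ≤ γ₁' * Real.sqrt ((L : ℝ)⁻¹) ^ k * Real.exp (-(κΓ * (distK L (fine (Lb * 1) (cubic (d + 1) (s t))) x q.1 + distK L (fine (Lb * 1) (cubic (d + 1) (s t))) x q.2)))) →
      (∀ t k x q, ‖(Γ₂ t (k + 1) - Γ₂ t k) x q‖ ≤ γ₂' * Real.sqrt ((L : ℝ)⁻¹) ^ k * Real.exp (-(κΓ * (distK L (fine (Lb * 1) (cubic (d + 1) (s t))) x q.1 + distK L (fine (Lb * 1) (cubic (d + 1) (s t))) x q.2)))) →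
      (∀ k (μ' l l' : Fin (d + 1)) (z u v : Fin (d + 1) → ℤ), ∃ s' : ℂ, Tendsto (fun t => Γ₁ t k ((unitIdx L (fine (Lb * 1) (cubic (d + 1) (s t)))).symm (castT (fine (Lb * 1) (cubic (d + 1) (s t))) z, μ')) (((unitIdx L (fine (Lb * 1) (cubic (d + 1) (s t)))).symm (castT (fine (Lb * 1) (cubic (d + 1) (s t))) u, l)), ((unitIdx L (fine (Lb * 1) (cubic (d + 1) (s t)))).symm (castT (fine (Lb * 1) (cubic (d + 1) (s t))) v, l')))) atTop (𝓝 s')) →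
      (∀ k (μ' l l' : Fin (d + 1)) (z u v : Fin (d + 1) → ℤ), ∃ s' : ℂ, Tendsto (fun t => Γ₂ t k ((unitIdx L (fine (Lb * 1) (cubic (d + 1) (s t)))).symm (castT (fine (Lb * 1) (cubic (d + 1) (s t))) z, μ')) (((unitIdx L (fine (Lb * 1) (cubic (d + 1) (s t)))).symm (castT (fine (Lb * 1) (cubic (d + 1) (s t))) u, l)), ((unitIdx L (fine (Lb * 1) (cubic (d + 1) (s t)))).symm (castT (fine (Lb * 1) (cubic (d + 1) (s t))) v, l')))) atTop (𝓝 s')) →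
      ∃ Pinf : ℕ → B12Beta.Kernel (d + 1),
        (∀ k, IsInfiniteVolumeLimit (fun t => Lb * 1 * s t)
          (fun t μ' ν' (z : Beta.Site (d + 1) (Lb * 1 * s t)) => ((Γ₁ t k * ((((unitCovB L (fine (Lb * 1) (cubic (d + 1) (s t))) a ha k)⁻¹ * (((flucCov (reM (DelK (lev L k) (one_le_lev' L k) (fine (Lb * 1) (cubic (d + 1) (s t))) a ha)) (Matrix.fromRows (reM (QB 1 Lb (cubic (d + 1) (s t)))) (fun (t' : {x : Tor (fine (Lb * 1) (cubic (d + 1) (s t))) × Fin (d + 1) // (∀ ν, ν < x.2 → ((rem 1 Lb (cubic (d + 1) (s t)) x.1 ν : ℕ)) = 0) ∧ ((rem 1 Lb (cubic (d + 1) (s t)) x.1 x.2 : ℕ)) + 1 < Lb}) (x : Tor (fine (Lb * 1) (cubic (d + 1) (s t))) × Fin (d + 1)) => if x = (Function.Embedding.subtype (fun x : Tor (fine (Lb * 1) (cubic (d + 1) (s t))) × Fin (d + 1) => (∀ ν, ν < x.2 → ((rem 1 Lb (cubic (d + 1) (s t)) x.1 ν : ℕ)) = 0) ∧ ((rem 1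 Lb (cubic (d + 1) (s t)) x.1 x.2 : ℕ)) + 1 < Lb)) t' then (1 : ℝ) else 0))).map ((↑) : ℝ → ℂ)).submatrix (unitIdx L (fine (Lb * 1) (cubic (d + 1) (s t)))) (unitIdx L (fine (Lb * 1) (cubic (d + 1) (s t))))) * (unitCovB L (fine (Lb * 1) (cubic (d + 1) (s t))) a ha k)⁻¹)) ⊗ₖ ((unitCovB L (fine (Lb * 1) (cubic (d + 1) (s t))) a ha k)⁻¹)) * (Γ₂ t k)ᴴ) ((unitIdx L (fine (Lb * 1) (cubic (d + 1) (s t)))).symm (z, μ')) ((unitIdx L (fine (Lb * 1) (cubic (d + 1) (s t)))).symm (0, ν'))).re) (Pinf k)) ∧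
        Beta.LimitRate.UniformDecay Pinf μ ν (γ₁ * γ₂ * C) ((κ₁ / 4) / (((d + 1 : ℕ)) : ℝ)) ∧
        StepRate Pinf μ ν (((γ₁' * γ₂ + γ₁ * γ₂') * C + γ₁ * γ₂ * C')) ((κ₁ / 4) / (((d + 1 : ℕ)) : ℝ)) (Real.sqrt ((L : ℝ)⁻¹)) ∧
        (∃ K : KernelInputs (d + 1) Pinf, K.θ = Real.sqrt ((L : ℝ)⁻¹) ∧ K.c₀ = betaPrime510 (d + 1) ((((γ₁' * γ₂ + γ₁ * γ₂') * C + γ₁ * γ₂ * C')) / (1 - Real.sqrt ((L : ℝ)⁻¹))) ((κ₁ / 4) / (((d + 1 : ℕ)) : ℝ)) ∧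
          K.Pinf = limKernelOf Pinf ∧ K.μ = μ ∧ K.ν = ν) ∧
        (∀ k, |B12Beta.secondMoment (Pinf k) μ ν - B12Beta.secondMoment (limKernelOf Pinf) μ ν|
            ≤ betaPrime510 (d + 1) ((((γ₁' * γ₂ + γ₁ * γ₂') * C + γ₁ * γ₂ * C')) / (1 - Real.sqrt ((L : ℝ)⁻¹))) ((κ₁ / 4) / (((d + 1 : ℕ)) : ℝ)) * Real.sqrt ((L : ℝ)⁻¹) ^ k) := by
  have hd' : 2 ≤ d + 1 := by omega
  have hL1 : (1 : ℝ) < L := by exact_mod_cast (lt_of_lt_of_le one_lt_two hL : 1 < L)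
  have hθ0 : 0 ≤ Real.sqrt ((L : ℝ)⁻¹) := Real.sqrt_nonneg _
  have hθ1 : Real.sqrt ((L : ℝ)⁻¹) < 1 := by
    rw [show (1 : ℝ) = Real.sqrt 1 from Real.sqrt_one.symm]
    exact Real.sqrt_lt_sqrt (inv_nonneg.mpr (Nat.cast_nonneg _)) (inv_lt_one_of_one_lt₀ hL1)
  have hside : Tendsto (fun t => Lb * 1 * s t) atTop atTop :=
    Filter.tendsto_atTop_mono (fun t => Nat.le_mul_of_pos_left _ (Nat.pos_of_ne_zero (NeZero.ne (Lb * 1)))) hs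
  -- the two triples: `Y = c⁻¹𝒢c⁻¹` (PART 195, auxiliary mass `1`) and `Z = c⁻¹` (PART 195 §1)
  obtain ⟨κ₀, B₁, B₁', hκ₀, hB₁, hudY, hsrY, helY⟩ := exists_loopCov_inputs L a ha Lb s hL hd hs one_pos
  have hB₁' : 0 ≤ B₁' := by
    haveI : Nonempty (idx L (fine (Lb * 1) (cubic (d + 1) (s 0))) 0) := ⟨(unitIdx L _).symm (0, μ)⟩
    exact twoLevelDecayRate_const_nonneg (hsrY 0)
  obtain ⟨κ', Bs, B₂', hκ', hBs, hB₂', hudZ, hsrZ, helZ⟩ := inv_unitCovB_inputs L a ha hL hd (fun t => Lb * 1 * s t) hside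
  have hB₂ : 0 ≤ Bs + ‖(a : ℂ)‖ * 1 := by positivity
  -- common rate `κ₁ = min (min κ₀ κ′) κ_Γ`
  have hκ₁ : 0 < min (min κ₀ κ') κΓ := lt_min (lt_min hκ₀ hκ') hκΓ
  have hκ₁Y : min (min κ₀ κ') κΓ ≤ κ₀ := (min_le_left _ _).trans (min_le_left _ _)
  have hκ₁Z : min (min κ₀ κ') κΓ ≤ κ' := (min_le_left _ _).trans (min_le_right _ _)
  obtain ⟨hudY', hsrY'⟩ := inputs_of_le_rate L (side := fun t => Lb * 1 * s t) hB₁ hB₁' hθ0 hκ₁Y hudY hsrY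
  obtain ⟨hudZ', hsrZ'⟩ := inputs_of_le_rate L (side := fun t => Lb * 1 * s t) hB₂ hB₂' hθ0 hκ₁Z hudZ hsrZ
  -- an envelope at rate `κ_Γ` is one at rate `κ₁` (level and step envelopes alike: the prefactor is `≥ 0`)
  have hweak : ∀ {c : ℝ} (G : (t : ℕ) → Matrix (idx L (fine (Lb * 1) (cubic (d + 1) (s t))) 0) (idx L (fine (Lb * 1) (cubic (d + 1) (s t))) 0 × idx L (fine (Lb * 1) (cubic (d + 1) (s t))) 0) ℂ), 0 ≤ c →
      (∀ t x q, ‖G t x q‖ ≤ c * Real.exp (-(κΓ * (distK L (fine (Lb * 1) (cubic (d + 1) (s t))) x q.1 + distK L (fine (Lb * 1) (cubic (d + 1) (s t))) x q.2)))) →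
      ∀ t x q, ‖G t x q‖ ≤ c * Real.exp (-(min (min κ₀ κ') κΓ * (distK L (fine (Lb * 1) (cubic (d + 1) (s t))) x q.1 + distK L (fine (Lb * 1) (cubic (d + 1) (s t))) x q.2))) := by
    intro c G hc hG t x q
    refine (hG t x q).trans (mul_le_mul_of_nonneg_left (Real.exp_le_exp.mpr ?_) hc)
    have h0 : 0 ≤ distK L (fine (Lb * 1) (cubic (d + 1) (s t))) x q.1 + distK L (fine (Lb * 1) (cubic (d + 1) (s t))) x q.2 := add_nonneg (distK_nonneg L _ _ _) (distK_nonneg L _ _ _)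
    nlinarith [min_le_right (min κ₀ κ') κΓ]
  obtain ⟨C, C', hC, hC', h⟩ := conv_twoKernel_of_inputs_moving L hd' (side := fun t => Lb * 1 * s t) hside
    (Y := fun t k => ((unitCovB L (fine (Lb * 1) (cubic (d + 1) (s t))) a ha k)⁻¹ * (((flucCov (reM (DelK (lev L k) (one_le_lev' L k) (fine (Lb * 1) (cubic (d + 1) (s t))) a ha)) (Matrix.fromRows (reM (QB 1 Lb (cubic (d + 1) (s t)))) (fun (t' : {x : Tor (fine (Lb * 1) (cubic (d + 1) (s t))) × Fin (d + 1) // (∀ ν, ν < x.2 → ((rem 1 Lb (cubic (d + 1) (s t)) x.1 ν : ℕ)) = 0) ∧ ((rem 1 Lb (cubic (d + 1) (s t)) x.1 x.2 : ℕ)) + 1 < Lb}) (x : Tor (fine (Lb * 1) (cubic (d + 1) (s t))) × Fin (d + 1)) => if x = (Function.Embedding.subtype (fun x : Tor (fine (Lb * 1) (cubic (d + 1) (s t))) × Fin (d + 1) => (∀ ν, ν < x.2 → ((rem 1 Lb (cubic (d + 1) (s t)) x.1 ν : ℕ)) = 0) ∧ ((rem 1 Lb (cubic (d + 1) (s t))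 x.1 x.2 : ℕ)) + 1 < Lb)) t' then (1 : ℝ) else 0))).map ((↑) : ℝ → ℂ)).submatrix (unitIdx L (fine (Lb * 1) (cubic (d + 1) (s t)))) (unitIdx L (fine (Lb * 1) (cubic (d + 1) (s t))))) * (unitCovB L (fine (Lb * 1) (cubic (d + 1) (s t))) a ha k)⁻¹)) (Z := fun t k => (unitCovB L (fine (Lb * 1) (cubic (d + 1) (s t))) a ha k)⁻¹) hκ₁ hB₁ hB₁' hB₂ hB₂' hθ0 hθ1 hudY' hsrY' hudZ' hsrZ' helY helZ hne
  refine ⟨min (min κ₀ κ') κΓ, C, C', hκ₁, min_le_right _ _, hC, hC', fun γ₁ γ₂ γ₁' γ₂' hγ₁ hγ₂ hγ₁' hγ₂' Γ₁ Γ₂ hΓ₁ hΓ₂ hΓ₁' hΓ₂' =>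
    h γ₁ γ₂ γ₁' γ₂' hγ₁ hγ₂ hγ₁' hγ₂' Γ₁ Γ₂ (fun t k => hweak (fun t' => Γ₁ t' k) hγ₁ (fun t' => hΓ₁ t' k) t)
      (fun t k => hweak (fun t' => Γ₂ t' k) hγ₂ (fun t' => hΓ₂ t' k) t)
      (fun t k => hweak (fun t' => Γ₁ t' (k + 1) - Γ₁ t' k) (mul_nonneg hγ₁' (pow_nonneg hθ0 k)) (fun t' => hΓ₁' t' k) t)
      (fun t k => hweak (fun t' => Γ₂ t' (k + 1) - Γ₂ t' k) (mul_nonneg hγ₂' (pow_nonneg hθ0 k)) (fun t' => hΓ₂' t' k) t)⟩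

end LoopInv

/-! ## §4 The legs discharged: localised Lipschitz families, and the tent family -/

section Legs

variable (Lb : ℕ) [NeZero Lb] (a : ℝ) (ha : 0 < a)

/-- **`conv_loopCov_invCov_insertionLegs` — THE TADPOLE-SHAPED CONTRACTION `Γ_{t,k}(Y_{t,k} ⊗ₖ c_{k,t}⁻¹)Γ_{t,k}ᴴ` WITH THE INSERTION-WORD LEGS OF EVERY LOCALISED LIPSCHITZ FAMILY WITH
POINTWISE LIMITS, ON `ℤ^{d+1}`** [our proof] (`d + 1 ≥ 3`, `L ≥ 2`, every `Lb ≥ 1`, `a > 0`, `μ ≠ ν`, coarse volumes `2(t+1)`; backgrounds as in PART 200): `∃ κ₁ > 0, C, C′ ≥ 0, Π` with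
the whole `LimitRate` END — §3 fed with PART 200's `insertionLegs_envelopes` ∕ `insertionLegs_tendsto`.  NO residual hypothesis on the legs. [cite: Balaban1987RG1, (1.20)–(1.22) p.264 (shapes)] -/
theorem conv_loopCov_invCov_insertionLegs (hL : 2 ≤ L) (hd : 2 ≤ d) {μ ν : Fin (d + 1)} (hne : μ ≠ ν) {α β c₀ : ℝ}
    {V : (t : ℕ) → idx L (fine (Lb * 1) (cubic (d + 1) (evenPeriod t))) 0 → (k : ℕ) → Fin (d + 1) → (idx L (fine (Lb * 1) (cubic (d + 1) (evenPeriod t))) k → ℂ)}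
    (hV : ∀ t i, LipschitzBackground L (fine (Lb * 1) (cubic (d + 1) (evenPeriod t))) (V t i) α β)
    (hloc : ∀ t i k μ u, V t i k μ u ≠ 0 → rho L (fine (Lb * 1) (cubic (d + 1) (evenPeriod t))) k i u ≤ c₀)
    (hel : ∀ (z : Fin (d + 1) → ℤ) (μ' : Fin (d + 1)) (k : ℕ) (μ f : Fin (d + 1)) (w : Fin (d + 1) → ℤ), ∃ s : ℂ,
      Tendsto (fun t => V t ((unitIdx L (fine (Lb * 1) (cubic (d + 1) (evenPeriod t)))).symm (castT (fine (Lb * 1) (cubic (d + 1) (evenPeriod t))) z, μ')) k μ (castT (fine (lev L k) (fine (Lb * 1) (cubic (d + 1) (evenPeriod t)))) w, f)) atTop (𝓝 s)) :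
    ∃ κ₁ C C' : ℝ, 0 < κ₁ ∧ 0 ≤ C ∧ 0 ≤ C' ∧ ∃ Pinf : ℕ → B12Beta.Kernel (d + 1),
      (∀ k, IsInfiniteVolumeLimit (fun t => Lb * 1 * evenPeriod t)
        (fun t μ' ν' (z : Beta.Site (d + 1) (Lb * 1 * evenPeriod t)) => (((Matrix.of fun (x : idx L (fine (Lb * 1) (cubic (d + 1) (evenPeriod t))) 0) (q : idx L (fine (Lb * 1) (cubic (d + 1) (evenPeriod t))) 0 × idx L (fine (Lb * 1) (cubic (d + 1) (evenPeriod t))) 0) => avgTow (QBlev L (fine (Lb * 1) (cubic (d + 1) (evenPeriod t)))) ((L : ℝ) ^ (d + 1)) (fun k => calGlev L (fine (Lb * 1) (cubic (d + 1) (evenPeriod t))) a ha k * Pmodel L (fine (Lb * 1) (cubic (d + 1) (evenPeriod t))) (V t x) k * calGlev L (fine (Lb * 1) (cubic (d + 1) (evenPeriod t))) a ha k) k q.1 q.2) * ((((unitCovB L (fine (Lb * 1) (cubic (d + 1) (evenPeriod t))) a ha k)⁻¹ * (((flucCov (reM (DelK (lev L k) (one_le_lev' L k) (fine (Lb * 1)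 (cubic (d + 1) (evenPeriod t))) a ha)) (Matrix.fromRows (reM (QB 1 Lb (cubic (d + 1) (evenPeriod t)))) (fun (t' : {x : Tor (fine (Lb * 1) (cubic (d + 1) (evenPeriod t))) × Fin (d + 1) // (∀ ν, ν < x.2 → ((rem 1 Lb (cubic (d + 1) (evenPeriod t)) x.1 ν : ℕ)) = 0) ∧ ((rem 1 Lb (cubic (d + 1) (evenPeriod t)) x.1 x.2 : ℕ)) + 1 < Lb}) (x : Tor (fine (Lb * 1) (cubic (d + 1) (evenPeriod t))) × Fin (d + 1)) => if x = (Function.Embedding.subtype (fun x : Tor (fine (Lb * 1) (cubic (d + 1) (evenPeriod t))) × Fin (d + 1) => (∀ ν, ν < x.2 → ((rem 1 Lb (cubic (d + 1) (evenPeriod t)) x.1 ν : ℕ)) = 0) ∧ ((rem 1 Lb (cubic (d + 1) (evenPeriod t)) x.1 x.2 : ℕ)) + 1 < Lb)) t' then (1 : ℝ) else 0))).map ((↑) : ℝ → ℂ)).submatrix (unitIdx L (fine (Lb * 1) (cubic (d + 1) (evenPeriod t)))) (unitIdx L (fine (Lb * 1) (cubic (d + 1) (evenPeriod t))))) * (unitCovB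 L (fine (Lb * 1) (cubic (d + 1) (evenPeriod t))) a ha k)⁻¹)) ⊗ₖ ((unitCovB L (fine (Lb * 1) (cubic (d + 1) (evenPeriod t))) a ha k)⁻¹)) * ((Matrix.of fun (x : idx L (fine (Lb * 1) (cubic (d + 1) (evenPeriod t))) 0) (q : idx L (fine (Lb * 1) (cubic (d + 1) (evenPeriod t))) 0 × idx L (fine (Lb * 1) (cubic (d + 1) (evenPeriod t))) 0) => avgTow (QBlev L (fine (Lb * 1) (cubic (d + 1) (evenPeriod t)))) ((L : ℝ) ^ (d + 1)) (fun k => calGlev L (fine (Lb * 1) (cubic (d + 1) (evenPeriod t))) a ha k * Pmodel L (fine (Lb * 1) (cubic (d + 1) (evenPeriod t))) (V t x) k * calGlev L (fine (Lb * 1) (cubic (d + 1) (evenPeriod t))) a ha k) k q.1 q.2))ᴴ) ((unitIdx L (fine (Lb * 1) (cubic (d + 1) (evenPeriod t)))).symm (z, μ')) ((unitIdx L (fine (Lb * 1) (cubic (d + 1) (evenPeriod t)))).symm (0, ν'))).re) (Pinf k)) ∧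
      Beta.LimitRate.UniformDecay Pinf μ ν C ((κ₁ / 4) / (((d + 1 : ℕ)) : ℝ)) ∧
      StepRate Pinf μ ν C' ((κ₁ / 4) / (((d + 1 : ℕ)) : ℝ)) (Real.sqrt ((L : ℝ)⁻¹)) ∧
      (∃ K : KernelInputs (d + 1) Pinf, K.θ = Real.sqrt ((L : ℝ)⁻¹) ∧ K.c₀ = betaPrime510 (d + 1) (C' / (1 - Real.sqrt ((L : ℝ)⁻¹))) ((κ₁ / 4) / (((d + 1 : ℕ)) : ℝ)) ∧
        K.Pinf = limKernelOf Pinf ∧ K.μ = μ ∧ K.ν = ν) ∧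
      (∀ k, |B12Beta.secondMoment (Pinf k) μ ν - B12Beta.secondMoment (limKernelOf Pinf) μ ν|
          ≤ betaPrime510 (d + 1) (C' / (1 - Real.sqrt ((L : ℝ)⁻¹))) ((κ₁ / 4) / (((d + 1 : ℕ)) : ℝ)) * Real.sqrt ((L : ℝ)⁻¹) ^ k) := by
  obtain ⟨κΓ, B, B', hκΓ, hB, hB', henv⟩ := insertionLegs_envelopes L Lb a ha hL α β c₀
  obtain ⟨h1, h2⟩ := henv evenPeriod V hV hloc
  obtain ⟨κ₁, C, C', hκ₁, -, hC, hC', h⟩ := conv_loopCov_invCov_moving_of_rate (L := L) (Lb := Lb) (a := a) (ha := ha) (s := evenPeriod) hL (by omega)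
    tendsto_evenPeriod hne hκΓ
  obtain ⟨Pinf, hP⟩ := h B B B' B' hB hB hB' hB'
    (fun t k => (Matrix.of fun (x : idx L (fine (Lb * 1) (cubic (d + 1) (evenPeriod t))) 0) (q : idx L (fine (Lb * 1) (cubic (d + 1) (evenPeriod t))) 0 × idx L (fine (Lb * 1) (cubic (d + 1) (evenPeriod t))) 0) => avgTow (QBlev L (fine (Lb * 1) (cubic (d + 1) (evenPeriod t)))) ((L : ℝ) ^ (d + 1)) (fun k => calGlev L (fine (Lb * 1) (cubic (d + 1) (evenPeriod t))) a ha k * Pmodel L (fine (Lb * 1) (cubic (d + 1) (evenPeriod t))) (V t x) k * calGlev L (fine (Lb * 1) (cubic (d + 1) (evenPeriod t))) a ha k) k q.1 q.2))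
    (fun t k => (Matrix.of fun (x : idx L (fine (Lb * 1) (cubic (d + 1) (evenPeriod t))) 0) (q : idx L (fine (Lb * 1) (cubic (d + 1) (evenPeriod t))) 0 × idx L (fine (Lb * 1) (cubic (d + 1) (evenPeriod t))) 0) => avgTow (QBlev L (fine (Lb * 1) (cubic (d + 1) (evenPeriod t)))) ((L : ℝ) ^ (d + 1)) (fun k => calGlev L (fine (Lb * 1) (cubic (d + 1) (evenPeriod t))) a ha k * Pmodel L (fine (Lb * 1) (cubic (d + 1) (evenPeriod t))) (V t x) k * calGlev L (fine (Lb * 1) (cubic (d + 1) (evenPeriod t))) a ha k) k q.1 q.2))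
    h1 h1 h2 h2 (fun k μ' l l' z u v => insertionLegs_tendsto L Lb a ha hd hV hel k μ' l l' z u v)
    (fun k μ' l l' z u v => insertionLegs_tendsto L Lb a ha hd hV hel k μ' l l' z u v)
  exact ⟨κ₁, B * B * C, (B' * B + B * B') * C + B * B * C', hκ₁, by positivity, by positivity, Pinf, hP⟩

/-- **`conv_loopCov_invCov_tentLegs` — THE SAME FOR THE TENT FAMILY, NOTHING DISPLAYED** [our proof] (`d + 1 ≥ 3`, `L ≥ 2`, every `Lb ≥ 1`, `a > 0`, `μ ≠ ν`; the tent family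
`V_{t,x}^{(k)}(u) = [μ = x₂]·max(−ρ_{k,x}(u), 0)` DISPLAYED as the hypothesis `hVdef`): PART 201 ∕ 202 feed `conv_loopCov_invCov_insertionLegs`. [cite: Balaban1987RG1, (1.20)–(1.22) p.264 (shapes)] -/
theorem conv_loopCov_invCov_tentLegs (hL : 2 ≤ L) (hd : 2 ≤ d) {μ ν : Fin (d + 1)} (hne : μ ≠ ν)
    {V : (t : ℕ) → idx L (fine (Lb * 1) (cubic (d + 1) (evenPeriod t))) 0 → (k : ℕ) → Fin (d + 1) → (idx L (fine (Lb * 1) (cubic (d + 1) (evenPeriod t))) k → ℂ)}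
    (hVdef : ∀ t x k μ u, V t x k μ u = if μ = x.2 then (((max (-rho L (fine (Lb * 1) (cubic (d + 1) (evenPeriod t))) k x u) 0 : ℝ)) : ℂ) else 0) :
    ∃ κ₁ C C' : ℝ, 0 < κ₁ ∧ 0 ≤ C ∧ 0 ≤ C' ∧ ∃ Pinf : ℕ → B12Beta.Kernel (d + 1),
      (∀ k, IsInfiniteVolumeLimit (fun t => Lb * 1 * evenPeriod t)
        (fun t μ' ν' (z : Beta.Site (d + 1) (Lb * 1 * evenPeriod t)) => (((Matrix.of fun (x : idx L (fine (Lb * 1) (cubic (d + 1) (evenPeriod t))) 0) (q : idx L (fine (Lb * 1) (cubic (d + 1) (evenPeriod t))) 0 × idx L (fine (Lb * 1) (cubic (d + 1) (evenPeriod t))) 0) => avgTow (QBlev L (fine (Lb * 1) (cubic (d + 1) (evenPeriod t)))) ((L : ℝ) ^ (d + 1)) (fun k => calGlev L (fine (Lb * 1) (cubic (d + 1) (evenPeriod t))) a ha k * Pmodel L (fine (Lb * 1) (cubic (d + 1) (evenPeriod t))) (V t x) k * calGlev L (fine (Lb * 1) (cubic (d + 1) (evenPeriod t))) a ha k) k q.1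 q.2) * ((((unitCovB L (fine (Lb * 1) (cubic (d + 1) (evenPeriod t))) a ha k)⁻¹ * (((flucCov (reM (DelK (lev L k) (one_le_lev' L k) (fine (Lb * 1) (cubic (d + 1) (evenPeriod t))) a ha)) (Matrix.fromRows (reM (QB 1 Lb (cubic (d + 1) (evenPeriod t)))) (fun (t' : {x : Tor (fine (Lb * 1) (cubic (d + 1) (evenPeriod t))) × Fin (d + 1) // (∀ ν, ν < x.2 → ((rem 1 Lb (cubic (d + 1) (evenPeriod t)) x.1 ν : ℕ)) = 0) ∧ ((rem 1 Lb (cubic (d + 1) (evenPeriod t)) x.1 x.2 : ℕ)) + 1 < Lb}) (x : Tor (fine (Lb * 1) (cubic (d + 1) (evenPeriod t))) × Fin (d + 1)) => if x = (Function.Embedding.subtype (fun x : Tor (fine (Lb * 1) (cubic (d + 1) (evenPeriod t))) × Fin (d + 1) => (∀ ν, ν < x.2 → ((rem 1 Lb (cubic (d + 1) (evenPeriod t)) x.1 ν : ℕ)) = 0) ∧ ((rem 1 Lb (cubic (d + 1) (evenPeriod t)) x.1 x.2 : ℕ)) + 1 < Lb)) t' then (1 : ℝ) else 0))).map ((↑)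 : ℝ → ℂ)).submatrix (unitIdx L (fine (Lb * 1) (cubic (d + 1) (evenPeriod t)))) (unitIdx L (fine (Lb * 1) (cubic (d + 1) (evenPeriod t))))) * (unitCovB L (fine (Lb * 1) (cubic (d + 1) (evenPeriod t))) a ha k)⁻¹)) ⊗ₖ ((unitCovB L (fine (Lb * 1) (cubic (d + 1) (evenPeriod t))) a ha k)⁻¹)) * ((Matrix.of fun (x : idx L (fine (Lb * 1) (cubic (d + 1) (evenPeriod t))) 0) (q : idx L (fine (Lb * 1) (cubic (d + 1) (evenPeriod t))) 0 × idx L (fine (Lb * 1) (cubic (d + 1) (evenPeriod t))) 0) => avgTow (QBlev L (fine (Lb * 1) (cubic (d + 1) (evenPeriod t)))) ((L : ℝ) ^ (d + 1)) (fun k => calGlev L (fine (Lb * 1) (cubic (d + 1) (evenPeriod t))) a ha k * Pmodel L (fine (Lb * 1) (cubic (d + 1) (evenPeriod t))) (V t x) k * calGlev L (fine (Lb * 1) (cubic (d + 1) (evenPeriod t))) a ha k) k q.1 q.2))ᴴ) ((unitIdx L (fine (Lb * 1) (cubic (d + 1) (evenPeriod t)))).symm (z, μ')) ((unitIdx L (fine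 (Lb * 1) (cubic (d + 1) (evenPeriod t)))).symm (0, ν'))).re) (Pinf k)) ∧
      Beta.LimitRate.UniformDecay Pinf μ ν C ((κ₁ / 4) / (((d + 1 : ℕ)) : ℝ)) ∧
      StepRate Pinf μ ν C' ((κ₁ / 4) / (((d + 1 : ℕ)) : ℝ)) (Real.sqrt ((L : ℝ)⁻¹)) ∧
      (∃ K : KernelInputs (d + 1) Pinf, K.θ = Real.sqrt ((L : ℝ)⁻¹) ∧ K.c₀ = betaPrime510 (d + 1) (C' / (1 - Real.sqrt ((L : ℝ)⁻¹))) ((κ₁ / 4) / (((d + 1 : ℕ)) : ℝ)) ∧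
        K.Pinf = limKernelOf Pinf ∧ K.μ = μ ∧ K.ν = ν) ∧
      (∀ k, |B12Beta.secondMoment (Pinf k) μ ν - B12Beta.secondMoment (limKernelOf Pinf) μ ν|
          ≤ betaPrime510 (d + 1) (C' / (1 - Real.sqrt ((L : ℝ)⁻¹))) ((κ₁ / 4) / (((d + 1 : ℕ)) : ℝ)) * Real.sqrt ((L : ℝ)⁻¹) ^ k) :=
  conv_loopCov_invCov_insertionLegs L Lb a ha hL hd hne (α := 1) (β := 1) (c₀ := 0)
    (fun t i => lipschitzBackground_tent L (fine (Lb * 1) (cubic (d + 1) (evenPeriod t))) (le_trans (by norm_num) hL) i (hVdef t i))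
    (fun t i k μ₀ u h => rho_nonpos_of_tent_ne_zero L (fine (Lb * 1) (cubic (d + 1) (evenPeriod t))) i (hVdef t i) k μ₀ u h)
    (fun z μ' k μ₀ f w => tendsto_tent_reading L (D := d + 1) (side := fun t => Lb * 1 * evenPeriod t)
      (Filter.Tendsto.const_mul_atTop' (Nat.pos_of_ne_zero (NeZero.ne (Lb * 1))) tendsto_evenPeriod) (V := V) hVdef z μ' k μ₀ f w)

end Legs

end Summit.QuantumFields.BalabanUV.Beta.GAN24.OneStepLoopContractionTwoKernels

end
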